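import Summits.QuantumFields.BalabanUV.Beta.GAN24.ContactBorderPartner

/-!
# `GAN24.ContactOneGaugeCellBorder` — CT-ROUTE step «CT-3aV»: THE ONE-GAUGE CONTACT CELLS OF THE BORDER TABLE `vhSAt ρ` ARE
# `⟨T, (ψ-difference across one coarse bond)·q¹,ρ·M⟩` AND ARE BOUNDED BY «ENVELOPES IN, `2^{d+1}·ℓ·e^{2κ₀(d+1)L}·N^{d+1}·Zl·e^{−κ′·spread}` OUT»
# (the row owner's CALL [GAN24P1-G19-P1] «→ leaf-02: the V∕H ONE-GAUGE CELL BOUNDS … = CT-3aV ∕ CT-3aH»; the V half, part 2 of 2)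

HONEST FRAMING (cell charter, verbatim): «discharging `BetaPertH` makes Bałaban's UV stability UNCONDITIONAL — a real constructive-QFT result;
it is NOT the continuum limit and NOT the Clay problem.»  DERIVED cell leaf (pub-balaban, G-an2-4 formalisation swarm → CRUX TEAM (2), seat
`b2b-balaban-gan24-formalise-leaf-02`, gen 47): [folklore] bookkeeping (a finite box sum of at most `2^{d+1}` coarse bonds, one block-label wobble, the triangle
inequality, leaf-12's free block sum) over `GAN24.BorderGaugeLegContact` (the fluctuation-slot law), an1's (S-V)ρ `AveragingWardRootedStencils.divV_vhSAt_apply`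
(the index-slot law) and `GAN24.ContactOneGaugeCellBound` ∕ `EnvelopeBlockSum` BY NAME; NO cited fact, NO `def`, NO `def … : Prop`, NO wall binder; the constants are
symbolic inputs.  It discharges NO letter of (CONV-C): the cell bounds are inputs of the owner's bornSec assembly (v1.2 §D (D2)); NEVER «G-an2-4 closed»; NOT hS0,
NOT D1, NOT `BetaPertH`, NOT continuum, NOT Clay.  «not in print; our bookkeeping».
HONEST DEPENDENCY (cell records, verbatim): «continuum YM on T⁴ ⇐ BetaPertH ∧ nine spine estimates (0/9 proved); BetaPertH ⇐ (D1) ∧ (D4) ∧ CAP+tail;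
G-an2-4 gates asym, D1 and NE2/3/4.»
ABSOLUTE RULE (cell charter, verbatim): «No internally-minted statement may enter as a cited fact. Every hypothesis is either kernel-proved in this
package or a verbatim quotation of a PUBLISHED theorem with page reference. The manuscript(s) under audit are NOT citable for their own disputed steps —
they are the thing under adjudication; programme-internal (2001/route/tribunal) claims are never citable.»

THE OBJECTS (generic `d`, `ℤ^(d+1)`; the TABLE's one-step blocking `L ≥ 1` with a box root `ρ = toSite r`, `r ∈ box (d+1) L`; the LEGS' envelope blocking `N ≥ 1`
(the chain's coarse lattice), envelope `E_z(u) := e^{−κ₀‖quo N u − z‖∞}`; `ℓ := ell d L = (2d+2)·L`).  Legs: an INDEX∕fluctuation leg `T` (a 1-form on fine bonds,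
`|T κ u| ≤ E₁·E_{z₁}(u)`), a MULTIPLIER-slot leg `M μ z` (read at the fine images `z` of the coarse sites; `|M μ z| ≤ E₃·E_{z₃}(z)`), a gauge function `ψ`
(`|ψ x| ≤ Eψ·E_{z₀}(x)` — leaf-01's `Psi_delta1_envelope` shape); the contact partner is an1's packed rooted first-order kernel `q := linSymAt ρ L`
(`AveragingWardRootedStencils`), whose `(inl κ, inr μ)` entry at `(u, z)` is `q¹,ρ_{(μ, z/L)}(κ, u)`, supported on `z ∈ L·ℤ^(d+1)`, `u ∈` the `2L`-box of the block
`z/L` (`linKerAt_eq_zero`), and bounded by `ℓ` (`abs_linKerAt_le`).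
## What is proved
* (part 1 `GAN24.ContactBorderPartner`: the partner's support ∕ size ∕ near-box ∕ proximity letters, the index-slot law in `dψ`-form `tsum_dz_mul_vhSAt_idx`, and the
  two enveloped contact kernels `abs_fluWeight_mul_linSymAt_le` ∕ `abs_idxWeight_mul_linSymAt_le`.)
* §3 THE GENERIC CELL BOUND **`abs_cell_border_le`** (index-leg OUTER, multiplier leg inside, a contact kernel `K κ u μ z` supported where `q ≠ 0` and
  enveloped at the leg site): `|Σ'_u Σ_κ T κ u · Σ'_z Σ_μ M μ z · K κ u μ z| ≤ (d+1)²·2^{d+1}·e^{2κ₀(d+1)L}·E₁E₃E_K·(N^{d+1}·Zl(κ₀∕(4(d+1)))·e^{−(κ₀∕12)(‖z₁−z₀‖∞+‖z₃−z₀‖∞)})`.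
* §4 THE TWO V CELLS: gauge in the FLUCTUATION slot — **`cellVflu_eq`** (`= Σ'_u Σ_κ T κ u · Σ'_z Σ_μ M μ z · (ψ(u + e_κ) − ψ(z + ρ + L·e_μ))·q(u,z)(inl κ)(inr μ)`, by
  `tsum_dz_mul_vhSAt`) and **`abs_cellVflu_le`** (weight letter `E_K = 2·Eψ·e^{2κ₀(d+1)L}·ℓ`); gauge in the INDEX slot — **`cellVidx_eq`** (`(ψ(z + ρ) − ψ x)·q`) and
  **`abs_cellVidx_le`** (same letter).  MAIN ORDER: with `Eψ = O(N^{−D})`, `E₁, E₃ = O(N^{−(D+1)})` and the free block sum `N^{D}` the cell is `O(N^{−2D−2})·ℓ`-sized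
  BEFORE the bornSec unit weights — the owner's X-gan24p1-g19-2 count decides; nothing about it is claimed here.
NOT HERE: the `(inr μ, inl κ)` placement (= the `(inl, inr)` cells with the slots exchanged, `vhSAt_symm`); the Hessian∕Λ cells (CT-3aH, sequel); the sym tables
(identical bounds with `linSym04At`, `abs_symLinKerAt_le` — on request); any assembly.
Provenance: seat b2b-balaban-gan24-formalise-leaf-02 gen 47 (prover-…-leaf-02-g47-0), 2026-08-21; over the files named above BY NAME.
-/

open Finset
open scoped BigOperators Nat
open Literature.MathematicalPhysics.QuantumFieldTheory.LatticeForm (quo)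
open Literature.MathematicalPhysics.QuantumFieldTheory.Balaban1983to89
open Literature.MathematicalPhysics.QuantumFieldTheory.Balaban1983to89.Beta
open AffineAveraging AveragingContours AveragingHessianKernels AveragingContoursRooted AveragingHessianKernelsRooted
open B12Sec2to5 (l1 l1_nonneg)
open B4ContourShift (supNorm supNorm_nonneg)
open ExpKernelCalculus (MKer Zl Zl_nonneg Zl_pos)
open OneStepResolventKernel (Fib)
open StepJetData (mfNeg mfNeg_inl_inl mfNeg_inl_inr mfNeg_inr_inl mfNeg_inr_inr l1_unitVec)
open KernelWard (divV)
open AveragingWardStencils (b6UnitVec_eq)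
open Summit.QuantumFields.BalabanUV.Beta.AveragingWardRootedStencils (linSymAt linSymAt_inl_inr linSymAt_inr_inl legSite legInd legInd_apply
  divV_vhSAt_apply)
open Summit.QuantumFields.BalabanUV.Beta.LinearGaugeVH (nearBox mem_nearBox summable_of_finsupp vhSAt_eq_zero_of_not_mem)
open Summit.QuantumFields.BalabanUV.Beta.GAN24.EnvelopeBlockSum (env_wobble env_le_one summable_env)
open Summit.QuantumFields.BalabanUV.Beta.GAN24.ContactOneGaugeCellBound (tsum_env3_le abs_le_of_env summable_of_env)
open Summit.QuantumFields.BalabanUV.Beta.GAN24.BorderGaugeLegContact (tsum_mul_ite_sub_ite_mul tsum_sum_dz_mul_eq tsum_dz_mul_vhSAt)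

open Summit.QuantumFields.BalabanUV.Beta.GAN24.ContactBorderPartner (off_eq_zero_and_near_of_linSymAt_ne_zero exists_finset_near_card
  l1_smul_sub_le_of_mem tsum_dz_mul_vhSAt_idx_inl_inr abs_fluWeight_mul_linSymAt_le abs_idxWeight_mul_linSymAt_le)

noncomputable section

namespace Summit.QuantumFields.BalabanUV.Beta.GAN24.ContactOneGaugeCellBorder

variable {d : ℕ}

/-! ## §3 The generic border cell bound (index leg outer, multiplier leg inside) -/

section Cell

variable {N L : ℕ} {κ₀ : ℝ} {r : Fin (d + 1) → ℕ}

/-- [folklore] **THE INNER (MULTIPLIER-LEG) SUM IS A FINITE BOX SUM AND IS ENVELOPED AT THE LEG SITE**: for a kernel `K κ u μ z` supported where the packed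
first-order kernel is (`z ∈ L·ℤ^(d+1)`, `u` in the box of `z/L`) and bounded by `E_K·E_{z₀}(u)`, and a multiplier leg `|M μ z| ≤ E₃·E_{z₃}(z)`:
`|Σ'_z Σ_μ M μ z · K κ u μ z| ≤ (d+1)·2^{d+1}·e^{2κ₀(d+1)L}·E₃·E_K·E_{z₃}(u)·E_{z₀}(u)` (every contributing `z` is within `|·|₁ ≤ (d+1)·2L` of `u`: one wobble). -/
theorem abs_inner_le (hN : 1 ≤ N) (hκ : 0 ≤ κ₀) (hL : 1 ≤ L) (hr : r ∈ box (d + 1) L) {M : Fin (d + 1) → (Fin (d + 1) → ℤ) → ℝ}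
    {K : Fin (d + 1) → (Fin (d + 1) → ℤ) → Fin (d + 1) → (Fin (d + 1) → ℤ) → ℝ} {z₀ z₃ : Fin (d + 1) → ℤ} {E₃ EK : ℝ} (hE₃ : 0 ≤ E₃) (hEK : 0 ≤ EK)
    (hM : ∀ μ z, |M μ z| ≤ E₃ * Real.exp (-(κ₀ * supNorm (quo N z - z₃))))
    (hKsupp : ∀ κ u μ z, K κ u μ z ≠ 0 → linSymAt (toSite r) L u z (Sum.inl κ) (Sum.inr μ) ≠ 0)
    (hK : ∀ κ u μ z, |K κ u μ z| ≤ EK * Real.exp (-(κ₀ * supNorm (quo N u - z₀)))) (κ : Fin (d + 1)) (u : Fin (d + 1) → ℤ) :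
    (Summable fun z => ∑ μ, M μ z * K κ u μ z) ∧
    |∑' z, ∑ μ, M μ z * K κ u μ z| ≤
      ((d : ℝ) + 1) * 2 ^ (d + 1) * Real.exp (κ₀ * (((d : ℝ) + 1) * (2 * (L : ℝ)))) * E₃ * EK *
        (Real.exp (-(κ₀ * supNorm (quo N u - z₃))) * Real.exp (-(κ₀ * supNorm (quo N u - z₀)))) := by
  classical
  obtain ⟨s, hcard, hs, hprox⟩ := exists_finset_near_card (d := d) hL u
  set S : Finset (Fin (d + 1) → ℤ) := s.image fun y => (L : ℤ) • y with hS
  -- support of the summand in the image of the near-set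
  have hzero : ∀ z ∉ S, (∑ μ, M μ z * K κ u μ z) = 0 := by
    intro z hz
    refine Finset.sum_eq_zero fun μ _ => ?_
    by_cases hKz : K κ u μ z = 0
    · rw [hKz, mul_zero]
    · exfalso
      obtain ⟨hoff, hnear⟩ := off_eq_zero_and_near_of_linSymAt_ne_zero hr (hKsupp κ u μ z hKz)
      exact hz (Finset.mem_image.2 ⟨blk L z, hs _ hnear, (eq_smul_blk_of_off_eq_zero hL hoff).symm⟩)
  have hsum : Summable fun z => ∑ μ, M μ z * K κ u μ z := summable_of_finsupp S hzero
  refine ⟨hsum, ?_⟩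
  rw [tsum_eq_sum (s := S) (fun z hz => hzero z hz)]
  -- uniform bound of each term on `S`
  have hterm : ∀ z ∈ S, |∑ μ, M μ z * K κ u μ z| ≤
      ((d : ℝ) + 1) * (Real.exp (κ₀ * (((d : ℝ) + 1) * (2 * (L : ℝ)))) * E₃ * EK *
        (Real.exp (-(κ₀ * supNorm (quo N u - z₃))) * Real.exp (-(κ₀ * supNorm (quo N u - z₀))))) := by
    intro z hz
    obtain ⟨y, hy, rfl⟩ := Finset.mem_image.1 hz
    have hl1 : l1 ((L : ℤ) • y - u) ≤ ((d : ℝ) + 1) * (2 * (L : ℝ)) := l1_smul_sub_le_of_mem (hprox y hy)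
    have hw : Real.exp (-(κ₀ * supNorm (quo N ((L : ℤ) • y) - z₃)))
        ≤ Real.exp (κ₀ * (((d : ℝ) + 1) * (2 * (L : ℝ)))) * Real.exp (-(κ₀ * supNorm (quo N u - z₃))) := by
      refine (env_wobble hN hκ z₃ u ((L : ℤ) • y)).trans ?_
      gcongr
    calc |∑ μ, M μ ((L : ℤ) • y) * K κ u μ ((L : ℤ) • y)| ≤ ∑ μ, |M μ ((L : ℤ) • y) * K κ u μ ((L : ℤ) • y)| := Finset.abs_sum_le_sum_abs _ _
      _ ≤ ∑ _μ : Fin (d + 1), Real.exp (κ₀ * (((d : ℝ) + 1) * (2 * (L : ℝ)))) * E₃ * EK *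
            (Real.exp (-(κ₀ * supNorm (quo N u - z₃))) * Real.exp (-(κ₀ * supNorm (quo N u - z₀)))) := by
          refine Finset.sum_le_sum fun μ _ => ?_
          rw [abs_mul]
          have h1 := hM μ ((L : ℤ) • y)
          have h2 := hK κ u μ ((L : ℤ) • y)
          have h0 : 0 ≤ |K κ u μ ((L : ℤ) • y)| := abs_nonneg _
          calc |M μ ((L : ℤ) • y)| * |K κ u μ ((L : ℤ) • y)|
              ≤ (E₃ * Real.exp (-(κ₀ * supNorm (quo N ((L : ℤ) • y) - z₃)))) * (EK * Real.exp (-(κ₀ * supNorm (quo N u - z₀)))) :=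
                mul_le_mul h1 h2 h0 (by positivity)
            _ ≤ (E₃ * (Real.exp (κ₀ * (((d : ℝ) + 1) * (2 * (L : ℝ)))) * Real.exp (-(κ₀ * supNorm (quo N u - z₃))))) *
                  (EK * Real.exp (-(κ₀ * supNorm (quo N u - z₀)))) := by gcongr
            _ = _ := by ring
      _ = ((d : ℝ) + 1) * (Real.exp (κ₀ * (((d : ℝ) + 1) * (2 * (L : ℝ)))) * E₃ * EK *
            (Real.exp (-(κ₀ * supNorm (quo N u - z₃))) * Real.exp (-(κ₀ * supNorm (quo N u - z₀))))) := by
          rw [Finset.sum_const, Finset.card_univ, Fintype.card_fin, nsmul_eq_mul]; push_cast; ring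
  have hScard : (S.card : ℝ) ≤ 2 ^ (d + 1) := by
    have h1 : S.card ≤ s.card := Finset.card_image_le
    exact_mod_cast h1.trans hcard
  have hB0 : 0 ≤ ((d : ℝ) + 1) * (Real.exp (κ₀ * (((d : ℝ) + 1) * (2 * (L : ℝ)))) * E₃ * EK *
        (Real.exp (-(κ₀ * supNorm (quo N u - z₃))) * Real.exp (-(κ₀ * supNorm (quo N u - z₀))))) := by positivity
  calc |∑ z ∈ S, ∑ μ, M μ z * K κ u μ z| ≤ ∑ z ∈ S, |∑ μ, M μ z * K κ u μ z| := Finset.abs_sum_le_sum_abs _ _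
    _ ≤ S.card • (((d : ℝ) + 1) * (Real.exp (κ₀ * (((d : ℝ) + 1) * (2 * (L : ℝ)))) * E₃ * EK *
        (Real.exp (-(κ₀ * supNorm (quo N u - z₃))) * Real.exp (-(κ₀ * supNorm (quo N u - z₀)))))) := Finset.sum_le_card_nsmul _ _ _ hterm
    _ ≤ _ := by
        rw [nsmul_eq_mul]
        calc (S.card : ℝ) * (((d : ℝ) + 1) * (Real.exp (κ₀ * (((d : ℝ) + 1) * (2 * (L : ℝ)))) * E₃ * EK *
              (Real.exp (-(κ₀ * supNorm (quo N u - z₃))) * Real.exp (-(κ₀ * supNorm (quo N u - z₀))))))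
            ≤ 2 ^ (d + 1) * (((d : ℝ) + 1) * (Real.exp (κ₀ * (((d : ℝ) + 1) * (2 * (L : ℝ)))) * E₃ * EK *
              (Real.exp (-(κ₀ * supNorm (quo N u - z₃))) * Real.exp (-(κ₀ * supNorm (quo N u - z₀)))))) :=
              mul_le_mul_of_nonneg_right hScard hB0
          _ = _ := by ring

/-- [folklore] **THE GENERIC BORDER CELL BOUND** (index leg OUTER): for an index leg `|T κ u| ≤ E₁·E_{z₁}(u)`, a multiplier leg `|M μ z| ≤ E₃·E_{z₃}(z)` and a contact
kernel `K` supported on the packed kernel's support and bounded by `E_K·E_{z₀}(u)`: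
`|Σ'_u Σ_κ T κ u · Σ'_z Σ_μ M μ z · K κ u μ z| ≤ (d+1)²·2^{d+1}·e^{2κ₀(d+1)L}·E₁E₃E_K·(N^{d+1}·Zl(κ₀∕(4(d+1)))·e^{−(κ₀∕12)(‖z₁−z₀‖∞+‖z₃−z₀‖∞)})` — envelopes in, one free
block sum out (`ContactOneGaugeCellBound.tsum_env3_le`). -/
theorem abs_cell_border_le (hN : 1 ≤ N) (hκ : 0 < κ₀) (hL : 1 ≤ L) (hr : r ∈ box (d + 1) L) {T : Form1 (d + 1) ℝ} {M : Fin (d + 1) → (Fin (d + 1) → ℤ) → ℝ}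
    {K : Fin (d + 1) → (Fin (d + 1) → ℤ) → Fin (d + 1) → (Fin (d + 1) → ℤ) → ℝ} {z₀ z₁ z₃ : Fin (d + 1) → ℤ} {E₁ E₃ EK : ℝ}
    (hE₁ : 0 ≤ E₁) (hE₃ : 0 ≤ E₃) (hEK : 0 ≤ EK)
    (hT : ∀ κ u, |T κ u| ≤ E₁ * Real.exp (-(κ₀ * supNorm (quo N u - z₁))))
    (hM : ∀ μ z, |M μ z| ≤ E₃ * Real.exp (-(κ₀ * supNorm (quo N z - z₃))))
    (hKsupp : ∀ κ u μ z, K κ u μ z ≠ 0 → linSymAt (toSite r) L u z (Sum.inl κ) (Sum.inr μ) ≠ 0)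
    (hK : ∀ κ u μ z, |K κ u μ z| ≤ EK * Real.exp (-(κ₀ * supNorm (quo N u - z₀)))) :
    (Summable fun u => ∑ κ, T κ u * ∑' z, ∑ μ, M μ z * K κ u μ z) ∧
    |∑' u, ∑ κ, T κ u * ∑' z, ∑ μ, M μ z * K κ u μ z| ≤
      ((d : ℝ) + 1) ^ 2 * 2 ^ (d + 1) * Real.exp (κ₀ * (((d : ℝ) + 1) * (2 * (L : ℝ)))) * E₁ * E₃ * EK *
        ((N : ℝ) ^ (d + 1) * Zl (d + 1) (κ₀ / (4 * ((d : ℝ) + 1))) * Real.exp (-(κ₀ / 12) * (supNorm (z₁ - z₀) + supNorm (z₃ - z₀)))) := by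
  set C : ℝ := ((d : ℝ) + 1) * 2 ^ (d + 1) * Real.exp (κ₀ * (((d : ℝ) + 1) * (2 * (L : ℝ)))) * E₃ * EK with hC
  have hC0 : 0 ≤ C := by positivity
  have hin : ∀ κ u, |∑' z, ∑ μ, M μ z * K κ u μ z| ≤
      C * (Real.exp (-(κ₀ * supNorm (quo N u - z₃))) * Real.exp (-(κ₀ * supNorm (quo N u - z₀)))) :=
    fun κ u => (abs_inner_le hN hκ.le hL hr hE₃ hEK hM hKsupp hK κ u).2
  obtain ⟨hPs, hP⟩ := tsum_env3_le (d := d) hN hκ z₀ z₁ z₃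
  set P : (Fin (d + 1) → ℤ) → ℝ := fun u => Real.exp (-(κ₀ * supNorm (quo N u - z₀))) * Real.exp (-(κ₀ * supNorm (quo N u - z₁))) *
        Real.exp (-(κ₀ * supNorm (quo N u - z₃))) with hPdef
  have hpt : ∀ u, |∑ κ, T κ u * ∑' z, ∑ μ, M μ z * K κ u μ z| ≤ ((d : ℝ) + 1) * E₁ * C * P u := by
    intro u
    calc |∑ κ, T κ u * ∑' z, ∑ μ, M μ z * K κ u μ z| ≤ ∑ κ, |T κ u * ∑' z, ∑ μ, M μ z * K κ u μ z| := Finset.abs_sum_le_sum_abs _ _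
      _ ≤ ∑ _κ : Fin (d + 1), E₁ * C * P u := by
          refine Finset.sum_le_sum fun κ _ => ?_
          rw [abs_mul]
          calc |T κ u| * |∑' z, ∑ μ, M μ z * K κ u μ z|
              ≤ (E₁ * Real.exp (-(κ₀ * supNorm (quo N u - z₁)))) *
                  (C * (Real.exp (-(κ₀ * supNorm (quo N u - z₃))) * Real.exp (-(κ₀ * supNorm (quo N u - z₀))))) :=
                mul_le_mul (hT κ u) (hin κ u) (abs_nonneg _) (by positivity)
            _ = E₁ * C * P u := by rw [hPdef]; ring
      _ = ((d : ℝ) + 1) * E₁ * C * P u := by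
          rw [Finset.sum_const, Finset.card_univ, Fintype.card_fin, nsmul_eq_mul]; push_cast; ring
  have hS : Summable fun u => ∑ κ, T κ u * ∑' z, ∑ μ, M μ z * K κ u μ z :=
    Summable.of_norm_bounded (hPs.mul_left (((d : ℝ) + 1) * E₁ * C)) (fun u => by rw [Real.norm_eq_abs]; exact hpt u)
  refine ⟨hS, ?_⟩
  have h1 : |∑' u, ∑ κ, T κ u * ∑' z, ∑ μ, M μ z * K κ u μ z| ≤ ∑' u, ((d : ℝ) + 1) * E₁ * C * P u := by
    refine (norm_tsum_le_tsum_norm hS.norm).trans ?_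
    simp only [Real.norm_eq_abs]
    exact Summable.tsum_le_tsum hpt hS.abs (hPs.mul_left _)
  rw [tsum_mul_left] at h1
  have h2 : ((d : ℝ) + 1) * E₁ * C * ∑' u, P u ≤ ((d : ℝ) + 1) * E₁ * C *
      ((N : ℝ) ^ (d + 1) * Zl (d + 1) (κ₀ / (4 * ((d : ℝ) + 1))) * Real.exp (-(κ₀ / 12) * (supNorm (z₁ - z₀) + supNorm (z₃ - z₀)))) :=
    mul_le_mul_of_nonneg_left hP (by positivity)
  calc |∑' u, ∑ κ, T κ u * ∑' z, ∑ μ, M μ z * K κ u μ z| ≤ ((d : ℝ) + 1) * E₁ * C * ∑' u, P u := h1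
    _ ≤ _ := h2
    _ = _ := by rw [hC]; ring

end Cell

/-! ## §4 The two border cells: gauge in the fluctuation slot, gauge in the index slot -/

section VCells

variable {N L : ℕ} {κ₀ : ℝ} {r : Fin (d + 1) → ℕ}

/-- [folklore] **THE FLUCTUATION-SLOT BORDER CELL, IDENTITY** (box root; a pure-gauge fluctuation leg `dψ` in the table's fluctuation slot, the index leg `T` outer,
the multiplier leg `M` inside): `Σ'_u Σ_κ T κ u · Σ'_z Σ_μ M μ z · (Σ'_x Σ_α (dz ψ) α x · V κ u x z (inl α) (inr μ))
  = Σ'_u Σ_κ T κ u · Σ'_z Σ_μ M μ z · ((ψ(u + e_κ) − ψ(z + ρ + L·e_μ)) · q(u, z)(inl κ)(inr μ))` (no hypothesis on the legs). -/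
theorem cellVflu_eq (hL : 1 ≤ L) (hr : r ∈ box (d + 1) L) (T : Form1 (d + 1) ℝ) (M : Fin (d + 1) → (Fin (d + 1) → ℤ) → ℝ)
    (ψ : (Fin (d + 1) → ℤ) → ℝ) :
    ∑' u, ∑ κ, T κ u * ∑' z, ∑ μ, M μ z * ∑' x, ∑ α, dz ψ α x * vhSAt (toSite r) d L rfl κ u x z (Sum.inl α) (Sum.inr μ)
      = ∑' u, ∑ κ, T κ u * ∑' z, ∑ μ, M μ z *
          ((ψ (u + unitVec κ) - ψ (z + toSite r + (L : ℤ) • unitVec μ)) * linSymAt (toSite r) L u z (Sum.inl κ) (Sum.inr μ)) := by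
  simp only [tsum_dz_mul_vhSAt hL hr]

/-- [folklore] **THE FLUCTUATION-SLOT BORDER CELL, BOUND** («envelopes in, `L`-constants·`N^{d+1}·Zl·e^{−κ′·spread}` out):
`|cellVflu| ≤ (d+1)²·2^{d+1}·e^{2κ₀(d+1)L}·E₁E₃·(2Eψ·e^{2κ₀(d+1)L}·ℓ)·(N^{d+1}·Zl(κ₀∕(4(d+1)))·e^{−(κ₀∕12)(‖z₁−z₀‖∞+‖z₃−z₀‖∞)})`. -/
theorem abs_cellVflu_le (hN : 1 ≤ N) (hκ : 0 < κ₀) (hL : 1 ≤ L) (hr : r ∈ box (d + 1) L) {T : Form1 (d + 1) ℝ} {M : Fin (d + 1) → (Fin (d + 1) → ℤ) → ℝ}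
    {ψ : (Fin (d + 1) → ℤ) → ℝ} {z₀ z₁ z₃ : Fin (d + 1) → ℤ} {E₁ E₃ Eψ : ℝ} (hE₁ : 0 ≤ E₁) (hE₃ : 0 ≤ E₃) (hEψ : 0 ≤ Eψ)
    (hT : ∀ κ u, |T κ u| ≤ E₁ * Real.exp (-(κ₀ * supNorm (quo N u - z₁))))
    (hM : ∀ μ z, |M μ z| ≤ E₃ * Real.exp (-(κ₀ * supNorm (quo N z - z₃))))
    (hψ : ∀ x, |ψ x| ≤ Eψ * Real.exp (-(κ₀ * supNorm (quo N x - z₀)))) :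
    |∑' u, ∑ κ, T κ u * ∑' z, ∑ μ, M μ z * ∑' x, ∑ α, dz ψ α x * vhSAt (toSite r) d L rfl κ u x z (Sum.inl α) (Sum.inr μ)| ≤
      ((d : ℝ) + 1) ^ 2 * 2 ^ (d + 1) * Real.exp (κ₀ * (((d : ℝ) + 1) * (2 * (L : ℝ)))) * E₁ * E₃ *
        (2 * Eψ * Real.exp (κ₀ * (((d : ℝ) + 1) * (2 * (L : ℝ)))) * (ell (d + 1) L : ℝ)) *
        ((N : ℝ) ^ (d + 1) * Zl (d + 1) (κ₀ / (4 * ((d : ℝ) + 1))) * Real.exp (-(κ₀ / 12) * (supNorm (z₁ - z₀) + supNorm (z₃ - z₀)))) := by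
  rw [cellVflu_eq hL hr]
  exact (abs_cell_border_le hN hκ hL hr (K := fun κ u μ z =>
      (ψ (u + unitVec κ) - ψ (z + toSite r + (L : ℤ) • unitVec μ)) * linSymAt (toSite r) L u z (Sum.inl κ) (Sum.inr μ))
    hE₁ hE₃ (by positivity) hT hM (fun κ u μ z h hq => h (by simp only [hq, mul_zero]))
    (fun κ u μ z => abs_fluWeight_mul_linSymAt_le hN hκ.le hL hr hEψ hψ κ u μ z)).2

/-- [folklore] **THE INDEX-SLOT BORDER CELL, IDENTITY** (a pure-gauge background `dψ` in the family index; the fluctuation-slot leg `T` outer, the multiplier leg `M`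
inside): `Σ'_x Σ_α T α x · Σ'_z Σ_μ M μ z · (Σ'_u Σ_κ (dz ψ) κ u · V κ u x z (inl α) (inr μ)) = Σ'_x Σ_α T α x · Σ'_z Σ_μ M μ z · ((ψ(z + ρ) − ψ x) · q(x, z)(inl α)(inr μ))`. -/
theorem cellVidx_eq (hL : 1 ≤ L) (hr : r ∈ box (d + 1) L) (T : Form1 (d + 1) ℝ) (M : Fin (d + 1) → (Fin (d + 1) → ℤ) → ℝ)
    (ψ : (Fin (d + 1) → ℤ) → ℝ) :
    ∑' x, ∑ α, T α x * ∑' z, ∑ μ, M μ z * ∑' u, ∑ κ, dz ψ κ u * vhSAt (toSite r) d L rfl κ u x z (Sum.inl α) (Sum.inr μ)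
      = ∑' x, ∑ α, T α x * ∑' z, ∑ μ, M μ z * ((ψ (z + toSite r) - ψ x) * linSymAt (toSite r) L x z (Sum.inl α) (Sum.inr μ)) := by
  simp only [tsum_dz_mul_vhSAt_idx_inl_inr hL hr]

/-- [folklore] **THE INDEX-SLOT BORDER CELL, BOUND** (same letter as the fluctuation-slot cell). -/
theorem abs_cellVidx_le (hN : 1 ≤ N) (hκ : 0 < κ₀) (hL : 1 ≤ L) (hr : r ∈ box (d + 1) L) {T : Form1 (d + 1) ℝ} {M : Fin (d + 1) → (Fin (d + 1) → ℤ) → ℝ}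
    {ψ : (Fin (d + 1) → ℤ) → ℝ} {z₀ z₁ z₃ : Fin (d + 1) → ℤ} {E₁ E₃ Eψ : ℝ} (hE₁ : 0 ≤ E₁) (hE₃ : 0 ≤ E₃) (hEψ : 0 ≤ Eψ)
    (hT : ∀ α x, |T α x| ≤ E₁ * Real.exp (-(κ₀ * supNorm (quo N x - z₁))))
    (hM : ∀ μ z, |M μ z| ≤ E₃ * Real.exp (-(κ₀ * supNorm (quo N z - z₃))))
    (hψ : ∀ x, |ψ x| ≤ Eψ * Real.exp (-(κ₀ * supNorm (quo N x - z₀)))) :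
    |∑' x, ∑ α, T α x * ∑' z, ∑ μ, M μ z * ∑' u, ∑ κ, dz ψ κ u * vhSAt (toSite r) d L rfl κ u x z (Sum.inl α) (Sum.inr μ)| ≤
      ((d : ℝ) + 1) ^ 2 * 2 ^ (d + 1) * Real.exp (κ₀ * (((d : ℝ) + 1) * (2 * (L : ℝ)))) * E₁ * E₃ *
        (2 * Eψ * Real.exp (κ₀ * (((d : ℝ) + 1) * (2 * (L : ℝ)))) * (ell (d + 1) L : ℝ)) *
        ((N : ℝ) ^ (d + 1) * Zl (d + 1) (κ₀ / (4 * ((d : ℝ) + 1))) * Real.exp (-(κ₀ / 12) * (supNorm (z₁ - z₀) + supNorm (z₃ - z₀)))) := by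
  rw [cellVidx_eq hL hr]
  exact (abs_cell_border_le hN hκ hL hr (K := fun α x μ z =>
      (ψ (z + toSite r) - ψ x) * linSymAt (toSite r) L x z (Sum.inl α) (Sum.inr μ))
    hE₁ hE₃ (by positivity) hT hM (fun α x μ z h hq => h (by simp only [hq, mul_zero]))
    (fun α x μ z => abs_idxWeight_mul_linSymAt_le hN hκ.le hL hr hEψ hψ α x μ z)).2

end VCells

end Summit.QuantumFields.BalabanUV.Beta.GAN24.ContactOneGaugeCellBorder

end
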